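import Literature.NumberTheory.PAdicHodge.AinfRamifiedWittKernel
import Literature.NumberTheory.PAdicHodge.AinfRamifiedTopology
import HarnessLib

/-!
# `A_inf(𝒪_F) = 𝔸_inf(F)[X]/(E)` over `W(k_F)` as a complete topological ring: `(p, ξ)`-adic completeness,
# the `(p, ω)`-adic topology, continuity of `θ_𝒪` and of `Γ_F`, the nil ideal `𝔫_𝒪 = θ_𝒪⁻¹(𝔪_{ℂ_F})`

Topic `Literature/NumberTheory/PAdicHodge`; the residue-degree-`f` version (Eisenstein datum `D : EisensteinRootW F p hp`
over `W(k_F)`, ring `AinfRamW D`) of `AinfRamifiedComplete` §2–§3 and `AinfRamifiedTopology` §1–§3, whose generic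
parts (`isAdicComplete_of_basis`, `isAdicComplete_of_ge_of_pow_le`) are reused by import.  Sequel of
`AinfRamifiedWittKernel` (`ω = ϖ − [π♭]`, `ker θ_𝒪 = (ω)`, `ω ∣ ξ`, `ω ∣ σ ω`).

* §1 **`J = (p, ξ) A_inf(𝒪_F)`** (`AinfRamW.idealPXi`); `A_inf(𝒪_F)` is `J`-adically complete (free of rank `e`
  over the `(p, ξ)`-adically complete `𝔸_inf(F)`); **`ϖ^e ∈ (p)`** (Eisenstein), **`[π♭]^e ∈ J`**, **`ω^{2e-1} ∈ J`**,
  `⋂ₖ ω^k A_inf(𝒪_F) = 0`.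
* §2 `AinfRamWTop D` — the type synonym with the **`𝔦 = (p, ω)`-adic topology** (Mathlib `WithIdeal`; same topology
  as `J`: `J ⊆ 𝔦`, `𝔦^{2e} ⊆ J`): complete, Hausdorff; ideals containing a power of `𝔦` are open and closed.
* §3 `AinfRamWTop.theta : A_inf(𝒪_F) → 𝒪_{ℂ_F}` (valued in `CBall F`) and `AinfRamWTop.gal σ` are **continuous**
  (`θ_𝒪(𝔦ⁿ) ⊆ pⁿ𝒪_{ℂ_F}`, `σ(𝔦) ⊆ 𝔦`); `θ_𝒪(a) = θ_𝒪(b) ⟹ a − b ∈ 𝔦`.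
* §4 `AinfRamWTop.nilTheta` — the closed ideal **`𝔫_𝒪 = θ_𝒪⁻¹(𝔪_{ℂ_F})`** of topologically nilpotent elements as a
  `LubinTate.NilIdeal` (domain of `LubinTate.evalPt`): `𝔦 ⊆ 𝔫_𝒪`, `θ_𝒪 : 𝔫_𝒪 ↠ 𝔪_{ℂ_F}`, `Γ_F`-stable, `ϖ ∈ 𝔫_𝒪`.

Definitions (reviewed): `AinfRamW.idealPXi` (abbrev), `AinfRamWTop`, `AinfRamWTop.of`, `.theta`, `.gal`, `.nilTheta`,
and the ring / `WithIdeal` / `CompleteSpace` / `T2Space` instances on the NEW type synonym `AinfRamWTop D` (exactly as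
for `AinfTop`, `AinfRamTop`).  No named facts, no `sorry`.

## References
* [FontaineAsterisque223III] J.-M. Fontaine, *Le corps des périodes p-adiques*, Astérisque 223 (1994), Exp. II §1.2
  (`θ`), §1.3 (topology of `A_inf`, completeness).
* [FarguesFontaine2018] L. Fargues, J.-M. Fontaine, Astérisque 406 (2018), §1.2, §2.2 (`W_{𝒪_E}(𝒪_{C♭})`, `θ`,
  `π − [π♭]`).
* [SerreLocalFields1979] J.-P. Serre, *Local Fields*, Ch. I §6 Prop. 17 (Eisenstein polynomials).
* [StacksProject] Tag 0317 (adic completeness).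
* [CasselsFrohlichANT1967] J.-P. Serre, *Local class field theory* (Cassels–Fröhlich Ch. VI) §3.2.
-/

noncomputable section

open Ideal WittVector MvPowerSeries Field ValuativeRel Polynomial

namespace Literature.NumberTheory.PAdicHodge

open Literature.NumberTheory.GaloisRepresentations
open Literature.NumberTheory.GaloisRepresentations.IsNonarchimedeanLocalField
open Literature.NumberTheory.GaloisRepresentations.LubinTate

variable {F : Type} [Field F] [ValuativeRel F] [TopologicalSpace F] [IsNonarchimedeanLocalField F]
  [CharZero F] {p : ℕ} [Fact p.Prime] [Fact (¬ IsUnit (p : integerC F))]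

/-! ## §1 `A_inf(𝒪_F)` is `(p, ξ)`-adically complete; `ϖ^e ∈ (p)`, `[π♭]^e ∈ J`, `ω^{2e-1} ∈ J` -/

namespace AinfRamW

variable {hp : valuation F p < 1} (D : EisensteinRootW F p hp)

/-- **The ideal `J = (p, ξ) A_inf(𝒪)`**: the extension of Fontaine's ideal of definition `(p, ξ) ⊆ 𝔸_inf(F)`.
[cite: FontaineAsterisque223III, Exp. II §1.3.1] -/
abbrev idealPXi : Ideal (AinfRamW D) :=
  (Ideal.span {(p : Ainf (p := p) F), xi}).map (algebraMap (Ainf (p := p) F) (AinfRamW D))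

/-- `J = (p, ξ)` as a span in `A_inf(𝒪)`. [cite: FontaineAsterisque223III, Exp. II §1.3.1] -/
theorem idealPXi_eq_span :
    idealPXi D = Ideal.span {(p : AinfRamW D), algebraMap (Ainf (p := p) F) (AinfRamW D) xi} := by
  rw [idealPXi, Ideal.map_span, Set.image_insert_eq, Set.image_singleton, map_natCast]

/-- `p ∈ J`. [cite: FontaineAsterisque223III, Exp. II §1.3.1] -/
theorem natCast_mem_idealPXi : (p : AinfRamW D) ∈ idealPXi D := by
  rw [idealPXi_eq_span]; exact Ideal.subset_span (Set.mem_insert _ _)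

/-- `ξ ∈ J`. [cite: FontaineAsterisque223III, Exp. II §1.3.1] -/
theorem algebraMap_xi_mem_idealPXi : algebraMap (Ainf (p := p) F) (AinfRamW D) xi ∈ idealPXi D := by
  rw [idealPXi_eq_span]; exact Ideal.subset_span (Set.mem_insert_of_mem _ rfl)

variable [IsAdicComplete (Ideal.span {(p : integerC F)}) (integerC F)]

/-- **`A_inf(𝒪)` is `(p, ξ)`-adically complete and separated** (free of rank `e` over the `(p, ξ)`-adically
complete `𝔸_inf(F)`, tree `isAdicComplete_span_p_xi`). [cite: FontaineAsterisque223III, Exp. II §1.3.2]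
[cite: FarguesFontaine2018, §1.2] -/
theorem isAdicComplete_idealPXi : IsAdicComplete (idealPXi D) (AinfRamW D) := by
  haveI : IsAdicComplete (Ideal.span {(p : Ainf (p := p) F), xi}) (Ainf (p := p) F) := isAdicComplete_span_p_xi
  haveI : IsAdicComplete (Ideal.span {(p : Ainf (p := p) F), xi}) (AinfRamW D) :=
    isAdicComplete_of_basis (powerBasis D).basis _
  exact (IsAdicComplete.map_algebraMap_iff (Ideal.span {(p : Ainf (p := p) F), xi}) (AinfRamW D)).2 inferInstance

/-- `A_inf(𝒪)` is `(p, ξ)`-adically separated: `⋂ₙ Jⁿ = 0`. [cite: FontaineAsterisque223III, Exp. II §1.3.2] -/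
theorem eq_zero_of_forall_mem_idealPXi_pow {x : AinfRamW D} (h : ∀ n : ℕ, x ∈ idealPXi D ^ n) : x = 0 := by
  haveI := isAdicComplete_idealPXi D
  refine IsHausdorff.haus (IsAdicComplete.toIsHausdorff (I := idealPXi D)) x fun n => ?_
  rw [SModEq.zero, smul_eq_mul, Ideal.mul_top]
  exact h n

set_option maxHeartbeats 400000 in
omit [IsAdicComplete (Ideal.span {(p : integerC F)}) (integerC F)] in
/-- **`ϖ^e ∈ p · A_inf(𝒪)`**: `ϖ^e = -(c₀ + ⋯ + c_{e-1}ϖ^{e-1})` with `p ∣ cᵢ` (Eisenstein).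
[cite: SerreLocalFields1979, Ch. I §6 Prop. 17] -/
theorem varpi_pow_mem_span_natCast : varpi D ^ D.deg ∈ Ideal.span {(p : AinfRamW D)} := by
  have h := eval₂_varpi' D
  rw [Polynomial.eval₂_eq_sum_range, Finset.sum_range_succ, ← D.deg_def,
    D.coeff_deg, map_one, one_mul] at h
  rw [eq_neg_of_add_eq_zero_right h]
  refine (Ideal.neg_mem_iff _).2 (Ideal.sum_mem _ fun i hi => ?_)
  -- (the cast `↑p` is moved across `c₀` by the one-line lemma `exists_wittFixedToAinf_coeff_eq`, never inside this goal)
  obtain ⟨d, hd⟩ := D.exists_wittFixedToAinf_coeff_eq (hp := hp) (Finset.mem_range.1 hi)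
  rw [RingHom.comp_apply, hd, map_mul, map_natCast, mul_assoc]
  exact Ideal.mul_mem_right _ _ (Ideal.mem_span_singleton_self _)

omit [IsAdicComplete (Ideal.span {(p : integerC F)}) (integerC F)] in
/-- `ϖ^e ∈ J`. [cite: SerreLocalFields1979, Ch. I §6 Prop. 17] -/
theorem varpi_pow_mem_idealPXi : varpi D ^ D.deg ∈ idealPXi D :=
  (Ideal.span_singleton_le_iff_mem _).2 (natCast_mem_idealPXi D) (varpi_pow_mem_span_natCast D)

/-- **`[ϖ♭]^e ∈ J`**: `[ϖ♭]^e = [(ϖ♭)^e] = [p♭]·[u] = (ξ + p)·[u]`. [cite: FarguesFontaine2018, §2.2] -/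
theorem algebraMap_teichmuller_unifFlat_pow_mem_idealPXi :
    algebraMap (Ainf (p := p) F) (AinfRamW D) (teichmuller p D.unifFlat) ^ D.deg ∈ idealPXi D := by
  obtain ⟨u, hu⟩ := D.exists_unifFlat_pow_eq_pFlat_mul
  have h1 : teichmuller p (pFlat : PreTilt (integerC F) p) = (xi : Ainf (p := p) F) + p := by rw [xi_def, sub_add_cancel]
  rw [← map_pow, ← map_pow, hu, map_mul, h1, map_mul, map_add, map_natCast]
  exact Ideal.mul_mem_right _ _ (Ideal.add_mem _ (algebraMap_xi_mem_idealPXi D) (natCast_mem_idealPXi D))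

/-- **`ω^{2e-1} ∈ J = (p, ξ) A_inf(𝒪)`** (binomial expansion of `(ϖ − [ϖ♭])^{2e-1}`: each monomial contains `ϖ^e` or
`[ϖ♭]^e`). Hence `(p, ξ)`, `(p, ω)` and `(ϖ, ω)` generate the same adic topology on `A_inf(𝒪)`.
[cite: FarguesFontaine2018, §1.2] -/
theorem omega_pow_mem_idealPXi : omega D ^ (D.deg + D.deg - 1) ∈ idealPXi D := by
  rw [omega_def, sub_eq_add_neg]
  refine Ideal.add_pow_add_pred_mem_of_pow_mem _ (varpi_pow_mem_idealPXi D) ?_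
  rw [neg_pow]
  exact Ideal.mul_mem_left _ _ (algebraMap_teichmuller_unifFlat_pow_mem_idealPXi D)

/-- `ω^{(2e-1)n} ∈ Jⁿ`. [cite: FarguesFontaine2018, §1.2] -/
theorem omega_pow_mul_mem_idealPXi_pow (n : ℕ) : omega D ^ ((D.deg + D.deg - 1) * n) ∈ idealPXi D ^ n := by
  rw [pow_mul]; exact Ideal.pow_mem_pow (omega_pow_mem_idealPXi D) n

/-- **`⋂ₖ ω^k A_inf(𝒪) = 0`**: an element divisible by every power of `ω` lies in every power of `J`, hence is `0`.
[cite: FontaineAsterisque223III, Exp. II §1.3.2] -/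
theorem eq_zero_of_forall_omega_pow_dvd {x : AinfRamW D} (h : ∀ k : ℕ, omega D ^ k ∣ x) : x = 0 :=
  eq_zero_of_forall_mem_idealPXi_pow D fun n => by
    obtain ⟨c, hc⟩ := h ((D.deg + D.deg - 1) * n)
    rw [hc]
    exact Ideal.mul_mem_right _ _ (omega_pow_mul_mem_idealPXi_pow D n)

end AinfRamW

variable {hp : valuation F p < 1}

/-! ## §2 `A_inf(𝒪_F)` with its `(p, ω)`-adic topology -/

/-- **`A_inf(𝒪)` as a topological ring**: the type synonym of `A_inf(𝒪) = 𝔸_inf(F)[ϖ]` carrying the `(p, ω)`-adic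
(`= (p, ξ)`-adic `= (ϖ, [ϖ♭])`-adic) topology. [cite: FontaineAsterisque223III, Exp. II §1.3.1] [cite: FarguesFontaine2018, §1.2] -/
def AinfRamWTop (D : EisensteinRootW F p hp) : Type := AinfRamW D

namespace AinfRamWTop

variable (D : EisensteinRootW F p hp)

/-- Ring structure (that of `A_inf(𝒪)`). [folklore] -/
instance : CommRing (AinfRamWTop D) := inferInstanceAs (CommRing (AinfRamW D))

/-- The preferred ideal `𝔦 = (p, ω)`, giving the adic topology, uniformity and linear topology through Mathlib's
`WithIdeal`. [cite: FontaineAsterisque223III, Exp. II §1.3.1] -/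
instance : WithIdeal (AinfRamWTop D) := ⟨(Ideal.span {(p : AinfRamW D), AinfRamW.omega D} : Ideal (AinfRamW D))⟩

/-- The identification `A_inf(𝒪) = AinfRamWTop D` (identity). [folklore] -/
def of : AinfRamW D ≃+* AinfRamWTop D := RingEquiv.refl _

/-- The defining ideal is `(p, ω)`. [cite: FontaineAsterisque223III, Exp. II §1.3.1] -/
theorem ideal_eq : (WithIdeal.i : Ideal (AinfRamWTop D)) = Ideal.span {(p : AinfRamWTop D), of D (AinfRamW.omega D)} := rfl

/-- The topology is the `(p, ω)`-adic one. [cite: FontaineAsterisque223III, Exp. II §1.3.1] -/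
theorem isAdic : IsAdic (WithIdeal.i : Ideal (AinfRamWTop D)) := rfl

/-- `p ∈ 𝔦`. [cite: FontaineAsterisque223III, Exp. II §1.3.1] -/
theorem natCast_mem_ideal : ((p : ℕ) : AinfRamWTop D) ∈ (WithIdeal.i : Ideal (AinfRamWTop D)) := by
  rw [ideal_eq]; exact Ideal.subset_span (Set.mem_insert _ _)

/-- `ω ∈ 𝔦`. [cite: FarguesFontaine2018, §2.2] -/
theorem of_omega_mem_ideal : of D (AinfRamW.omega D) ∈ (WithIdeal.i : Ideal (AinfRamWTop D)) := by
  rw [ideal_eq]; exact Ideal.subset_span (Set.mem_insert_of_mem _ rfl)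

/-- `ker θ_𝒪 = (ω) ⊆ 𝔦`: multiples of `ω` lie in `𝔦`. [cite: FarguesFontaine2018, §2.2] -/
theorem of_mem_ideal_of_omega_dvd {x : AinfRamW D} (h : AinfRamW.omega D ∣ x) : of D x ∈ (WithIdeal.i : Ideal (AinfRamWTop D)) := by
  obtain ⟨c, rfl⟩ := h
  exact Ideal.mul_mem_right _ _ (of_omega_mem_ideal D)

variable [IsAdicComplete (Ideal.span {(p : integerC F)}) (integerC F)]

/-- `(p, ξ) A_inf(𝒪) ⊆ 𝔦` (`ξ ∈ ω A_inf(𝒪)`). [cite: FarguesFontaine2018, §2.2] -/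
theorem map_idealPXi_le : (AinfRamW.idealPXi D).map (of D).toRingHom ≤ (WithIdeal.i : Ideal (AinfRamWTop D)) := by
  rw [AinfRamW.idealPXi_eq_span, Ideal.map_span, Ideal.span_le]
  rintro _ ⟨y, hy, rfl⟩
  simp only [Set.mem_insert_iff, Set.mem_singleton_iff] at hy
  rcases hy with rfl | rfl
  · rw [RingEquiv.toRingHom_eq_coe, RingHom.coe_coe, map_natCast]; exact natCast_mem_ideal D
  · exact of_mem_ideal_of_omega_dvd D (AinfRamW.omega_dvd_xi D)

/-- `𝔦^{2e} ⊆ (p, ξ) A_inf(𝒪)` (`ω^{2e-1} ∈ (p, ξ)`). [cite: FarguesFontaine2018, §1.2] -/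
theorem ideal_pow_le_map_idealPXi :
    (WithIdeal.i : Ideal (AinfRamWTop D)) ^ (1 + (D.deg + D.deg - 1)) ≤ (AinfRamW.idealPXi D).map (of D).toRingHom := by
  rw [ideal_eq, Ideal.span_insert]
  refine (Ideal.sup_pow_add_le_pow_sup_pow).trans (sup_le ?_ ?_)
  · rw [pow_one, Ideal.span_singleton_le_iff_mem]
    have h := Ideal.mem_map_of_mem (of D).toRingHom (AinfRamW.natCast_mem_idealPXi D)
    rwa [RingEquiv.toRingHom_eq_coe, RingHom.coe_coe, map_natCast] at h
  · rw [Ideal.span_singleton_pow, Ideal.span_singleton_le_iff_mem, ← map_pow]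
    exact Ideal.mem_map_of_mem (of D).toRingHom (AinfRamW.omega_pow_mem_idealPXi D)

/-- `A_inf(𝒪)` is `𝔦`-adically complete and separated. [cite: FontaineAsterisque223III, Exp. II §1.3.2] -/
theorem isAdicComplete_ideal : IsAdicComplete (WithIdeal.i : Ideal (AinfRamWTop D)) (AinfRamWTop D) := by
  haveI : IsAdicComplete ((AinfRamW.idealPXi D).map (of D)) (AinfRamWTop D) :=
    (IsAdicComplete.congr_ringEquiv (I := AinfRamW.idealPXi D) (of D)).2 (AinfRamW.isAdicComplete_idealPXi D)
  exact isAdicComplete_of_ge_of_pow_le (J := (AinfRamW.idealPXi D).map (of D)) (Nat.succ_pos _) (map_idealPXi_le D) (by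
    have h := ideal_pow_le_map_idealPXi D; rwa [Nat.one_add] at h)

/-- **`A_inf(𝒪)` is complete** for the `(p, ω)`-adic topology. [cite: FontaineAsterisque223III, Exp. II §1.3.2] -/
instance : CompleteSpace (AinfRamWTop D) := ((isAdic D).isAdicComplete_iff.1 (isAdicComplete_ideal D)).1

/-- **`A_inf(𝒪)` is Hausdorff** for the `(p, ω)`-adic topology. [cite: FontaineAsterisque223III, Exp. II §1.3.2] -/
instance : T2Space (AinfRamWTop D) := ((isAdic D).isAdicComplete_iff.1 (isAdicComplete_ideal D)).2

variable {D}

omit [IsAdicComplete (Ideal.span {(p : integerC F)}) (integerC F)] in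
/-- Powers of `𝔦` are neighbourhoods of `0`. [cite: FontaineAsterisque223III, Exp. II §1.3.1] -/
theorem pow_mem_nhds_zero (n : ℕ) : ((WithIdeal.i ^ n : Ideal (AinfRamWTop D)) : Set (AinfRamWTop D)) ∈ nhds 0 :=
  (Ideal.hasBasis_nhds_zero_adic (WithIdeal.i : Ideal (AinfRamWTop D))).mem_of_mem trivial

omit [IsAdicComplete (Ideal.span {(p : integerC F)}) (integerC F)] in
/-- An ideal containing a power of `𝔦` is open. [cite: FontaineAsterisque223III, Exp. II §1.3.1] -/
theorem isOpen_of_pow_le {J : Ideal (AinfRamWTop D)} {n : ℕ} (h : WithIdeal.i ^ n ≤ J) : IsOpen (J : Set (AinfRamWTop D)) :=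
  J.toAddSubgroup.isOpen_of_mem_nhds (Filter.mem_of_superset (pow_mem_nhds_zero n) h)

omit [IsAdicComplete (Ideal.span {(p : integerC F)}) (integerC F)] in
/-- An ideal containing a power of `𝔦` is closed. [cite: FontaineAsterisque223III, Exp. II §1.3.1] -/
theorem isClosed_of_pow_le {J : Ideal (AinfRamWTop D)} {n : ℕ} (h : WithIdeal.i ^ n ≤ J) : IsClosed (J : Set (AinfRamWTop D)) :=
  (⟨J.toAddSubgroup, isOpen_of_pow_le h⟩ : OpenAddSubgroup (AinfRamWTop D)).isClosed

omit [IsAdicComplete (Ideal.span {(p : integerC F)}) (integerC F)] in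
/-- An element some power of which lies in `𝔦` is topologically nilpotent. [cite: FontaineAsterisque223III, Exp. II §1.3] -/
theorem isTopologicallyNilpotent_of_pow_mem {a : AinfRamWTop D} {N : ℕ} (h : a ^ N ∈ (WithIdeal.i : Ideal (AinfRamWTop D))) :
    IsTopologicallyNilpotent a := by
  rw [IsTopologicallyNilpotent, (Ideal.hasBasis_nhds_zero_adic (WithIdeal.i : Ideal (AinfRamWTop D))).tendsto_right_iff]
  intro m _
  rw [Filter.eventually_atTop]
  refine ⟨N * m, fun n hn => ?_⟩
  obtain ⟨k, rfl⟩ := Nat.exists_eq_add_of_le hn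
  change a ^ (N * m + k) ∈ (WithIdeal.i ^ m : Ideal (AinfRamWTop D))
  rw [pow_add, pow_mul]
  exact Ideal.mul_mem_right _ _ (Ideal.pow_mem_pow h m)

/-! ## §3 `θ_𝒪` and the `Γ_F`-action as continuous ring homomorphisms -/

variable (D)

/-- **`θ_𝒪 : A_inf(𝒪) → 𝒪_{ℂ_F}`** on the topological ring `AinfRamWTop D`, valued in the closed unit ball `CBall F` of
`ℂ_F`. [cite: FarguesFontaine2018, §2.2] [cite: FontaineAsterisque223III, Exp. II §1.2.2] -/
def theta : AinfRamWTop D →+* CBall F :=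
  (integerCEquivCBall (F := F)).toRingHom.comp ((AinfRamW.theta D).comp (of D).symm.toRingHom)

variable {D}

/-- Unfolding `theta` in `ℂ_F`. [cite: FontaineAsterisque223III, Exp. II §1.2.2] -/
theorem coe_theta (a : AinfRamW D) :
    ((theta D (of D a) : CBall F) : CompletedAlgClosure F) = (AinfRamW.theta D a : integerC F) := rfl

/-- `θ_𝒪(p) = p`, `θ_𝒪(ω) = 0`: `θ_𝒪` maps `𝔦` into `p𝒪_{ℂ_F}`, hence `𝔦ⁿ` into `pⁿ𝒪_{ℂ_F}`.
[cite: FontaineAsterisque223III, Exp. II §1.2.2] -/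
theorem theta_mem_span_pow_of_mem_pow {n : ℕ} {a : AinfRamWTop D} (ha : a ∈ (WithIdeal.i ^ n : Ideal (AinfRamWTop D))) :
    theta D a ∈ Ideal.span {(p : CBall F)} ^ n := by
  have hmap : (WithIdeal.i : Ideal (AinfRamWTop D)).map (theta D) ≤ Ideal.span {(p : CBall F)} := by
    rw [ideal_eq, Ideal.map_span, Ideal.span_le]
    rintro _ ⟨y, hy, rfl⟩
    simp only [Set.mem_insert_iff, Set.mem_singleton_iff] at hy
    rcases hy with rfl | rfl
    · rw [map_natCast]; exact Ideal.subset_span rfl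
    · have h0 : theta D (of D (AinfRamW.omega D)) = 0 := by
        apply Subtype.ext
        rw [coe_theta, AinfRamW.theta_omega]; rfl
      rw [SetLike.mem_coe, h0]; exact Submodule.zero_mem _
  have h := Ideal.mem_map_of_mem (theta D) ha
  rw [Ideal.map_pow] at h
  exact Ideal.pow_right_mono hmap n h

/-- `‖θ_𝒪(a)‖ ≤ ‖p‖ⁿ` for `a ∈ 𝔦ⁿ`. [cite: FontaineAsterisque223III, Exp. II §1.2.2] -/
theorem norm_theta_le_of_mem_pow {n : ℕ} {a : AinfRamWTop D} (ha : a ∈ (WithIdeal.i ^ n : Ideal (AinfRamWTop D))) :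
    ‖((theta D a : CBall F) : CompletedAlgClosure F)‖ ≤ ‖(p : CompletedAlgClosure F)‖ ^ n := by
  have h := theta_mem_span_pow_of_mem_pow ha
  rw [Ideal.span_singleton_pow, Ideal.mem_span_singleton'] at h
  obtain ⟨b, hb⟩ := h
  rw [← hb, Subring.coe_mul, SubmonoidClass.coe_pow, norm_mul, norm_pow]
  have hb1 : ‖(b : CompletedAlgClosure F)‖ ≤ 1 := (LubinTate.mem_unitBall_iff _).1 b.2
  calc ‖(b : CompletedAlgClosure F)‖ * ‖((p : CBall F) : CompletedAlgClosure F)‖ ^ n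
      ≤ 1 * ‖((p : CBall F) : CompletedAlgClosure F)‖ ^ n := by gcongr
    _ = ‖(p : CompletedAlgClosure F)‖ ^ n := by rw [one_mul]; norm_cast

/-- **`θ_𝒪` is continuous** for the `(p, ω)`-adic topology on `A_inf(𝒪)` and the norm topology on `𝒪_{ℂ_F}`.
[cite: FontaineAsterisque223III, Exp. II §1.3] -/
theorem continuous_theta : Continuous (theta D) := by
  have hp1 : ‖(p : CompletedAlgClosure F)‖ < 1 := norm_natCast_C_lt_one'
  refine continuous_of_continuousAt_zero (theta D) ?_
  rw [ContinuousAt, map_zero, (Ideal.hasBasis_nhds_zero_adic (WithIdeal.i : Ideal (AinfRamWTop D))).tendsto_iff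
    Metric.nhds_basis_ball]
  intro ε hε
  obtain ⟨n, hn⟩ := exists_pow_lt_of_lt_one hε hp1
  refine ⟨n, trivial, fun a ha => ?_⟩
  rw [Metric.mem_ball, dist_zero_right]
  exact (norm_theta_le_of_mem_pow ha).trans_lt hn

/-- `θ_𝒪` is surjective on `AinfRamWTop` as soon as Fontaine's `θ` is. [cite: FontaineAsterisque223III, Exp. II §1.2.2] -/
theorem theta_surjective (hθ : Function.Surjective (fontaineTheta (integerC F) p)) : Function.Surjective (theta D) := fun y => by
  obtain ⟨a, ha⟩ := AinfRamW.theta_surjective D hθ ((integerCEquivCBall (F := F)).symm y)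
  exact ⟨of D a, by rw [theta, RingHom.comp_apply, RingHom.comp_apply]; simp [ha]⟩

/-- **`θ_𝒪(a) = θ_𝒪(b) ⟹ a − b ∈ 𝔦`** (`ker θ_𝒪 = (ω) ⊆ 𝔦`): lifts along `θ_𝒪` are well defined modulo `𝔦`.
[cite: FarguesFontaine2018, §2.2] -/
theorem sub_mem_ideal_of_theta_eq {a b : AinfRamWTop D} (h : theta D a = theta D b) :
    a - b ∈ (WithIdeal.i : Ideal (AinfRamWTop D)) := by
  have h1 : AinfRamW.theta D ((of D).symm (a - b)) = 0 := by
    have h2 : theta D (a - b) = 0 := by rw [map_sub, h, sub_self]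
    have h3 := congrArg (fun y : CBall F => (y : CompletedAlgClosure F)) h2
    exact Subtype.ext h3
  exact of_mem_ideal_of_omega_dvd D (AinfRamW.omega_dvd_of_theta_eq_zero D h1)

variable (D) in
/-- **The action of `σ ∈ Γ_F` on `A_inf(𝒪)`** (tree `AinfRamW.gal`) on the topological ring `AinfRamWTop D`.
[cite: FontaineAsterisque223III, Exp. II §1.2] -/
def gal (σ : absoluteGaloisGroup F) : AinfRamWTop D →+* AinfRamWTop D :=
  (of D).toRingHom.comp ((AinfRamW.gal D σ).comp (of D).symm.toRingHom)

omit [IsAdicComplete (Ideal.span {(p : integerC F)}) (integerC F)] in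
/-- Unfolding `gal`. [cite: FontaineAsterisque223III, Exp. II §1.2] -/
theorem gal_of (σ : absoluteGaloisGroup F) (a : AinfRamW D) : gal D σ (of D a) = of D (AinfRamW.gal D σ a) := rfl

/-- `θ_𝒪 ∘ σ = σ ∘ θ_𝒪` on `AinfRamWTop` (tree `AinfRamW.coe_theta_gal`). [cite: FontaineAsterisque223III, Exp. II §1.2] -/
theorem coe_theta_gal (σ : absoluteGaloisGroup F) (a : AinfRamWTop D) :
    ((theta D (gal D σ a) : CBall F) : CompletedAlgClosure F) = σ • ((theta D a : CBall F) : CompletedAlgClosure F) :=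
  AinfRamW.coe_theta_gal D σ a

/-- `σ` maps `𝔦 = (p, ω)` into itself (`σ p = p`, `σ ω ∈ ker θ_𝒪 = ω A_inf(𝒪)`). [cite: FontaineAsterisque223III, Exp. II §1.2] -/
theorem ideal_map_gal_le (σ : absoluteGaloisGroup F) :
    (WithIdeal.i : Ideal (AinfRamWTop D)).map (gal D σ) ≤ WithIdeal.i := by
  rw [ideal_eq, Ideal.map_span, Ideal.span_le]
  rintro _ ⟨y, hy, rfl⟩
  simp only [Set.mem_insert_iff, Set.mem_singleton_iff] at hy
  rcases hy with rfl | rfl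
  · rw [map_natCast]; exact Ideal.subset_span (by simp)
  · rw [SetLike.mem_coe, gal_of]
    exact of_mem_ideal_of_omega_dvd D (AinfRamW.omega_dvd_gal_omega D σ)

/-- **`σ` is continuous** on `AinfRamWTop` (indeed uniformly continuous). [cite: FontaineAsterisque223III, Exp. II §1.3] -/
theorem continuous_gal (σ : absoluteGaloisGroup F) : Continuous (gal D σ) :=
  (WithIdeal.uniformContinuous_of_map_le (ideal_map_gal_le σ)).continuous

/-! ## §4 The nil ideal `𝔫_𝒪 = θ_𝒪⁻¹(𝔪_{ℂ_F})` -/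

/-- If `θ_𝒪(a)^N ∈ p𝒪_{ℂ_F}` then `a^N ∈ 𝔦` (`ker θ_𝒪 ⊆ 𝔦`, `p ∈ 𝔦`). [cite: FontaineAsterisque223III, Exp. II §1.2–§1.3] -/
theorem pow_mem_ideal_of_theta_pow_mem (hθ : Function.Surjective (fontaineTheta (integerC F) p)) {a : AinfRamWTop D} {N : ℕ}
    (h : (theta D a) ^ N ∈ Ideal.span {(p : CBall F)}) : a ^ N ∈ (WithIdeal.i : Ideal (AinfRamWTop D)) := by
  obtain ⟨b, hb⟩ := Ideal.mem_span_singleton'.1 h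
  obtain ⟨c, hc⟩ := theta_surjective (D := D) hθ b
  rw [← hc] at hb
  have h1 : a ^ N - c * (p : AinfRamWTop D) ∈ (WithIdeal.i : Ideal (AinfRamWTop D)) :=
    sub_mem_ideal_of_theta_eq (by rw [map_pow, map_mul, map_natCast, hb])
  have : a ^ N = (a ^ N - c * (p : AinfRamWTop D)) + c * (p : AinfRamWTop D) := by ring
  rw [this]
  exact Ideal.add_mem _ h1 (Ideal.mul_mem_left _ _ (natCast_mem_ideal D))

/-- **Topological nilpotence of lifts of `𝔪_{ℂ_F}`**: if `‖θ_𝒪(a)‖ < 1` then `a^N ∈ 𝔦` for some `N`.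
[cite: FontaineAsterisque223III, Exp. II §1.3] -/
theorem exists_pow_mem_ideal_of_norm_lt_one (hθ : Function.Surjective (fontaineTheta (integerC F) p)) {a : AinfRamWTop D}
    (ha : ‖((theta D a : CBall F) : CompletedAlgClosure F)‖ < 1) : ∃ N : ℕ, a ^ N ∈ (WithIdeal.i : Ideal (AinfRamWTop D)) := by
  have hp0 : (p : CompletedAlgClosure F) ≠ 0 := natCast_C_ne_zero (Fact.out : p.Prime).ne_zero
  obtain ⟨N, hN⟩ := exists_pow_lt_of_lt_one (norm_pos_iff.2 hp0) ha
  refine ⟨N, pow_mem_ideal_of_theta_pow_mem hθ (Ideal.mem_span_singleton'.2 ?_)⟩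
  refine ⟨⟨((theta D a : CBall F) : CompletedAlgClosure F) ^ N / (p : CompletedAlgClosure F), ?_⟩, Subtype.ext ?_⟩
  · rw [LubinTate.mem_unitBall_iff, norm_div, norm_pow, div_le_one (norm_pos_iff.2 hp0)]
    exact hN.le
  · change _ / _ * ((p : CBall F) : CompletedAlgClosure F) = ((theta D a : CBall F) : CompletedAlgClosure F) ^ N
    push_cast
    rw [div_mul_cancel₀ _ hp0]

variable (D) in
/-- **The ideal `𝔫_𝒪 = θ_𝒪⁻¹(𝔪_{ℂ_F}) = {a ∈ A_inf(𝒪) : ‖θ_𝒪(a)‖ < 1}`** as a closed ideal of topologically nilpotent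
elements of `AinfRamWTop D`: the domain of the points of `𝒪`-formal groups with values in `A_inf(𝒪)`.
[cite: FontaineAsterisque223III, Exp. II §1.2–§1.3] [cite: CasselsFrohlichANT1967, Ch. VI §3.2] -/
def nilTheta (hθ : Function.Surjective (fontaineTheta (integerC F) p)) : NilIdeal (AinfRamWTop D) where
  toIdeal := (maxNilIdealC F).toIdeal.comap (theta D)
  isClosed := (maxNilIdealC F).isClosed.preimage continuous_theta
  isTopologicallyNilpotent a ha := by
    obtain ⟨N, hN⟩ := exists_pow_mem_ideal_of_norm_lt_one hθ ha
    exact isTopologicallyNilpotent_of_pow_mem hN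

/-- Membership in `𝔫_𝒪`: `‖θ_𝒪(a)‖ < 1`. [cite: FontaineAsterisque223III, Exp. II §1.2.2] -/
theorem mem_nilTheta_iff {hθ : Function.Surjective (fontaineTheta (integerC F) p)} {a : AinfRamWTop D} :
    a ∈ (nilTheta D hθ).toIdeal ↔ ‖((theta D a : CBall F) : CompletedAlgClosure F)‖ < 1 := Iff.rfl

/-- `θ_𝒪` maps `𝔫_𝒪` into `𝔪_{ℂ_F}`. [cite: FontaineAsterisque223III, Exp. II §1.2.2] -/
theorem theta_mem_maxNilIdealC {hθ : Function.Surjective (fontaineTheta (integerC F) p)} {a : AinfRamWTop D}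
    (ha : a ∈ (nilTheta D hθ).toIdeal) : theta D a ∈ (maxNilIdealC F).toIdeal := ha

/-- `𝔦 ⊆ 𝔫_𝒪` (`θ_𝒪(𝔦) = p𝒪_{ℂ_F}`). [cite: FontaineAsterisque223III, Exp. II §1.2.2] -/
theorem ideal_le_nilTheta {hθ : Function.Surjective (fontaineTheta (integerC F) p)} :
    (WithIdeal.i : Ideal (AinfRamWTop D)) ≤ (nilTheta D hθ).toIdeal := fun a ha => by
  rw [mem_nilTheta_iff]
  have h := norm_theta_le_of_mem_pow (n := 1) (by rwa [pow_one])
  rw [pow_one] at h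
  exact h.trans_lt norm_natCast_C_lt_one'

/-- **`θ_𝒪 : 𝔫_𝒪 → 𝔪_{ℂ_F}` is onto.** [cite: FontaineAsterisque223III, Exp. II §1.2.2] -/
theorem exists_theta_eq {hθ : Function.Surjective (fontaineTheta (integerC F) p)} (y : (maxNilIdealC F).toIdeal) :
    ∃ x : (nilTheta D hθ).toIdeal, theta D (x : AinfRamWTop D) = y := by
  obtain ⟨a, ha⟩ := theta_surjective hθ (y : CBall F)
  exact ⟨⟨a, show a ∈ (nilTheta D hθ).toIdeal by rw [mem_nilTheta_iff, ha]; exact y.2⟩, ha⟩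

/-- `𝔫_𝒪` is `Γ_F`-stable (`‖θ_𝒪(σ a)‖ = ‖σ θ_𝒪(a)‖ = ‖θ_𝒪(a)‖`). [cite: FontaineAsterisque223III, Exp. II §1.2] -/
theorem gal_mem_nilTheta {hθ : Function.Surjective (fontaineTheta (integerC F) p)} (σ : absoluteGaloisGroup F)
    {a : AinfRamWTop D} (ha : a ∈ (nilTheta D hθ).toIdeal) : gal D σ a ∈ (nilTheta D hθ).toIdeal := by
  rw [mem_nilTheta_iff, coe_theta_gal, CompletedAlgClosure.norm_smul]
  exact ha

/-- **`ϖ ∈ 𝔫_𝒪`** (`‖θ_𝒪(ϖ)‖ = ‖ϖ‖ < 1`): the uniformizer is a point of every `𝒪`-formal group. [cite: FarguesFontaine2018, §2.2] -/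
theorem of_varpi_mem_nilTheta {hθ : Function.Surjective (fontaineTheta (integerC F) p)} :
    of D (AinfRamW.varpi D) ∈ (nilTheta D hθ).toIdeal := by
  rw [mem_nilTheta_iff, coe_theta, AinfRamW.theta_varpi]
  exact D.norm_unifC_lt_one

end AinfRamWTop

end Literature.NumberTheory.PAdicHodge

end
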